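import Literature.AnabelianGeometry.AbsoluteAnabelian.NeukirchUchidaLocalInvariants
import Literature.AnabelianGeometry.AbsoluteAnabelian.NeukirchUchidaTransportGamma
import HarnessLib

/-!
# Neukirch–Uchida, step «local invariants» in the `Ω₀`-model: `D_A ⊓ Γ_K ≃ₜ* D_{A′} ⊓ Γ_{K′}` preserves
# the residue characteristic, `n_v`, `𝐍 v`, `f` and `e` (over `ℤ` and over `𝓞 ℚ`)

J. Neukirch, A. Schmidt, K. Wingberg, *Cohomology of Number Fields* (2nd ed. 2008), Ch. XII §2, proof of (12.2.1)
(local invariants transported along the prime correspondence; then arithmetic equivalence / Bauer).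

abc-iut cell, campaign L, GAP row G-L4d2g4-1, `plan/L4/SUBDAG-NeukirchUchida.md` row **R2 LOCAL-INVARIANTS**,
part 2 (abc-iut-w5-d116; the `Ω₀`-side shape asked for by the sub-DAG holder abc-iut-L4-d2 for row R4, 13:25Z).
PROOF-ONLY companion of `NeukirchUchidaLocalInvariants.lean` (part 1, abstract number fields): the sub-DAG works
inside `Γ = Gal(Ω₀/ℚ)`, `Ω₀ = AlgebraicClosure ℚ`, with number fields `K : IntermediateField ℚ Ω₀`, their open
subgroups `Γ_K = NeukirchUchidaProof.ΓK K` and transports `galTransport K : absoluteGaloisGroup ↥K ≃ₜ* Γ_K`,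
`closureEquiv K : AlgebraicClosure ↥K ≃ₐ[↥K] Ω₀` (abc-iut-w6-d055, row R0), decomposition groups
`D_A = MulAction.stabilizer Γ A` of valuation subrings `A ⊆ Ω₀`, and the place `v` of `↥K` under `A` in the
spelling `((x : ↥K) : Ω₀) ∈ 𝔪_A ↔ x ∈ 𝔭_v`.  This file transports part 1 to that model:

* `ramificationIdx_ringOfIntegersRat_eq_int'`, `inertiaDeg_ringOfIntegersRat_eq_int'` — `e`, `f` over `𝓞 ℚ` = over `ℤ` (Bauer's currency; the arguments of the
  tree's private lemmas in `CompletionLocalDegree.lean`, made public here);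
* `mem_nonunits_comap_closureEquiv_iff`, `exists_primesAbove_of_below` — the `Ω₀`-spelling of «`v` under `A`» is the
  part-1 spelling for the pulled-back subring `A.comap e_K`;
* `nonempty_decompositionGroupNF_comap_equiv_stabilizer_inf_ΓK` — `D_{↥K}(A.comap e_K) ≃ₜ* D_A ⊓ Γ_K`
  (abc-iut-w6-d055's `map_decompositionGroupNF_comap_galTransport`, as a topological isomorphism);
* **`invariants_of_stabilizer_inf_ΓK_equiv`** — for `e : ↥(D_A ⊓ Γ_K) ≃ₜ* ↥(D_{A′} ⊓ Γ_{K′})`: residue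
  characteristics, `localDeg`, `residueCard`, `inertiaDeg ℤ / (𝓞 ℚ)`, `ramificationIdx ℤ / (𝓞 ℚ)` of the places
  under `A`, `A′` coincide.

HONEST FRAMING: classical algebraic number theory; nothing here bears on [IUTchIII] Cor. 3.12 or takes a side.
-/

noncomputable section

open scoped NumberField Pointwise
open Field IsDedekindDomain ValuativeRel Literature.NumberTheory.GaloisRepresentations
open Literature.NumberTheory.NumberFields

namespace Literature.AnabelianGeometry.AbsoluteAnabelian

namespace NeukirchUchidaProof

/-! ### The `Ω₀`-model of the Neukirch–Uchida sub-DAG — invariants at `D_A ⊓ Γ_K ≃ₜ* D_{A′} ⊓ Γ_{K′}`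

abc-iut-L4-d2's R4 (arithmetic equivalence) works inside `Γ = Gal(Ω₀/ℚ)`, `Ω₀ = AlgebraicClosure ℚ`, with number
fields `K : IntermediateField ℚ Ω₀`, their open subgroups `Γ_K = NeukirchUchidaProof.ΓK K` (abc-iut-w6-d055, R0) and the
decomposition groups `D_A = MulAction.stabilizer Γ A` of valuation subrings `A ⊆ Ω₀`; the place of `↥K` under `A` is
`v` with `𝔭_v = 𝔪_A ∩ 𝓞_K`.  The theorems below transport §§1–3 to that model along R0's `galTransport K :
absoluteGaloisGroup ↥K ≃ₜ* Γ_K` and `closureEquiv K : AlgebraicClosure ↥K ≃ₐ[↥K] Ω₀`, and add the base-`𝓞 ℚ`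
spellings of `e` and `f` (Bauer's currency). -/

section BaseRat

variable {F : Type} [Field F] [NumberField F]

/-- **`e` over `𝓞 ℚ` is `e` over `ℤ`** for a prime of a number field (`ℤ → 𝓞 ℚ` onto, so the extended ideals in
`(𝓞 F)_q` agree; the argument of the tree's private `ramificationIdx_ringOfIntegersRat_eq_int`,
`CompletionLocalDegree.lean`). [cite: NeukirchANT1999, Ch. I §8 Prop. (8.3)] -/
theorem ramificationIdx_ringOfIntegersRat_eq_int' (q : Ideal (𝓞 F)) :
    q.ramificationIdx (𝓞 ℚ) = q.ramificationIdx ℤ := by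
  by_cases hq : q.IsPrime
  · rw [Ideal.ramificationIdx_def, Ideal.ramificationIdx_def]
    have hsurj : Function.Surjective (algebraMap ℤ (𝓞 ℚ)) := Rat.int_algebraMap_surjective (𝓞 ℚ)
    have hφ : algebraMap ℤ (Localization.AtPrime q) =
        (algebraMap (𝓞 ℚ) (Localization.AtPrime q)).comp (algebraMap ℤ (𝓞 ℚ)) :=
      RingHom.ext_int _ _
    have hunder : q.under ℤ = (q.under (𝓞 ℚ)).comap (algebraMap ℤ (𝓞 ℚ)) := by
      rw [Ideal.under_def, Ideal.under_def, Ideal.comap_comap, ← RingHom.ext_int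
        (algebraMap ℤ (𝓞 F)) ((algebraMap (𝓞 ℚ) (𝓞 F)).comp (algebraMap ℤ (𝓞 ℚ)))]
    have hI : (q.under ℤ).map (algebraMap ℤ (Localization.AtPrime q)) =
        (q.under (𝓞 ℚ)).map (algebraMap (𝓞 ℚ) (Localization.AtPrime q)) := by
      rw [hunder, hφ, ← Ideal.map_map, Ideal.map_comap_of_surjective _ hsurj]
    rw [hI]
  · rw [Ideal.ramificationIdx_of_not_isPrime q _ hq, Ideal.ramificationIdx_of_not_isPrime q _ hq]

/-- **`f` over `𝓞 ℚ` is `f` over `ℤ`** for a maximal ideal of a number field (tower `ℤ → 𝓞 ℚ → 𝓞 F` and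
`ℤ/(p) ≅ 𝓞 ℚ/𝔭`; the argument of the tree's private `inertiaDeg_ringOfIntegersRat_eq_int`).
[cite: NeukirchANT1999, Ch. I §8 Prop. (8.3)] -/
theorem inertiaDeg_ringOfIntegersRat_eq_int' (q : Ideal (𝓞 F)) [q.IsMaximal] :
    q.inertiaDeg (𝓞 ℚ) = q.inertiaDeg ℤ := by
  haveI hQ : (q.under (𝓞 ℚ)).IsMaximal := Ideal.IsMaximal.under (𝓞 ℚ) q
  have h1 : (q.under (𝓞 ℚ)).inertiaDeg ℤ = 1 := by
    set Q := q.under (𝓞 ℚ)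
    haveI : (Q.under ℤ).IsMaximal := Ideal.IsMaximal.under ℤ Q
    rw [← Ideal.inertiaDeg'_eq_inertiaDeg (Q.under ℤ) Q, Ideal.inertiaDeg'_algebraMap]
    letI : Field (ℤ ⧸ Q.under ℤ) := Ideal.Quotient.field _
    letI : Field (𝓞 ℚ ⧸ Q) := Ideal.Quotient.field _
    have hsurj : Function.Surjective (algebraMap (ℤ ⧸ Q.under ℤ) (𝓞 ℚ ⧸ Q)) := by
      intro y
      obtain ⟨y, rfl⟩ := Ideal.Quotient.mk_surjective y
      obtain ⟨x, rfl⟩ := Rat.int_algebraMap_surjective (𝓞 ℚ) y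
      exact ⟨Ideal.Quotient.mk _ x, rfl⟩
    have e : (ℤ ⧸ Q.under ℤ) ≃ₗ[ℤ ⧸ Q.under ℤ] (𝓞 ℚ ⧸ Q) :=
      LinearEquiv.ofBijective (Algebra.linearMap (ℤ ⧸ Q.under ℤ) (𝓞 ℚ ⧸ Q))
        ⟨(algebraMap (ℤ ⧸ Q.under ℤ) (𝓞 ℚ ⧸ Q)).injective, hsurj⟩
    rw [← e.finrank_eq, Module.finrank_self]
  rw [Ideal.inertiaDeg_tower (R := ℤ) (q.under (𝓞 ℚ)) q, h1, one_mul]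

end BaseRat

section OmegaModel

open NeukirchUchidaProof

variable (K : IntermediateField ℚ (AlgebraicClosure ℚ)) [NumberField K]

omit [NumberField K] in
/-- Non-units transport along `e_K`: `y ∈ (A.comap e_K).nonunits ↔ e_K y ∈ A.nonunits`.
[cite: NeukirchSchmidtWingberg2008, Ch. XII §2 (12.2.1)] -/
theorem mem_nonunits_comap_closureEquiv_iff (A : ValuationSubring (AlgebraicClosure ℚ)) (y : AlgebraicClosure K) :
    y ∈ (A.comap (closureEquiv K : AlgebraicClosure K →+* AlgebraicClosure ℚ)).nonunits ↔
      closureEquiv K y ∈ A.nonunits := by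
  rw [ValuationSubring.mem_nonunits_iff_or, ValuationSubring.mem_nonunits_iff_or,
    mem_comap_closureEquiv_iff, map_inv₀, map_eq_zero_iff _ (closureEquiv K).injective]

/-- The place under `A` in the `Ω₀`-spelling («`((x : ↥K) : Ω₀) ∈ 𝔪_A ↔ x ∈ 𝔭_v`») IS the place under the
pulled-back subring `A.comap e_K` in the spelling of §2 (a prime `𝔓` of `\bar ℤ_{↥K}` above `v` with `𝔓 = 𝔪 ∩ \bar ℤ`).
[cite: NeukirchSchmidtWingberg2008, Ch. XII §2 (12.2.1)] -/
theorem exists_primesAbove_of_below (A : ValuationSubring (AlgebraicClosure ℚ)) (hA : A ≠ ⊤)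
    (v : HeightOneSpectrum (𝓞 K))
    (hv : ∀ x : 𝓞 K, (((x : K) : AlgebraicClosure ℚ)) ∈ A.nonunits ↔ x ∈ v.asIdeal) :
    ∃ 𝔓 : Ideal (absIntegers (𝓞 K) K), 𝔓 ∈ v.primesAbove ∧
      ∀ s : absIntegers (𝓞 K) K, s ∈ 𝔓 ↔ (s : AlgebraicClosure K) ∈
        (A.comap (closureEquiv K : AlgebraicClosure K →+* AlgebraicClosure ℚ)).nonunits := by
  have hne : A.comap (closureEquiv K : AlgebraicClosure K →+* AlgebraicClosure ℚ) ≠ ⊤ :=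
    (comap_closureEquiv_ne_top_iff K A).mpr hA
  obtain ⟨w, 𝔓, h𝔓w, h𝔓⟩ := exists_ideal_mem_primesAbove_of_ne_top _ hne
  have hwv : w = v := by
    apply HeightOneSpectrum.ext
    ext x
    rw [mem_asIdeal_iff_algebraMap_mem_nonunits K _ w 𝔓 h𝔓w h𝔓 x, mem_nonunits_comap_closureEquiv_iff, ← hv,
      IsScalarTower.algebraMap_apply (𝓞 K) K (AlgebraicClosure K), AlgEquiv.commutes]
    rfl
  subst hwv
  exact ⟨𝔓, h𝔓w, h𝔓⟩

/-- **`D_{↥K}(A.comap e_K) ≃ₜ* D_A ⊓ Γ_K`**: abc-iut-w6-d055's `galTransport` restricted to the decomposition group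
of the pulled-back valuation subring lands onto the trace of `A`'s decomposition group on `Γ_K`
(`map_decompositionGroupNF_comap_galTransport`), as an isomorphism of topological groups.
[cite: NeukirchSchmidtWingberg2008, Ch. XII §2 (12.2.1)] -/
theorem nonempty_decompositionGroupNF_comap_equiv_stabilizer_inf_ΓK (A : ValuationSubring (AlgebraicClosure ℚ)) :
    Nonempty (decompositionGroupNF K (A.comap (closureEquiv K : AlgebraicClosure K →+* AlgebraicClosure ℚ)) ≃ₜ*
      ↥(MulAction.stabilizer (absoluteGaloisGroup ℚ) A ⊓ ΓK K)) := by
  set D := decompositionGroupNF K (A.comap (closureEquiv K : AlgebraicClosure K →+* AlgebraicClosure ℚ)) with hD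
  have hmem : ∀ σ : absoluteGaloisGroup K, σ ∈ D ↔
      ((galTransport K σ : ΓK K) : absoluteGaloisGroup ℚ) ∈ MulAction.stabilizer (absoluteGaloisGroup ℚ) A :=
    fun σ => mem_stabilizer_comap_iff_galTransport_mem K A σ
  refine ⟨
    { toFun := fun σ => ⟨(galTransport K σ.1 : absoluteGaloisGroup ℚ), (hmem σ.1).mp σ.2, (galTransport K σ.1).2⟩
      invFun := fun g => ⟨(galTransport K).symm ⟨g.1, g.2.2⟩, by
        rw [hmem, ContinuousMulEquiv.apply_symm_apply]; exact g.2.1⟩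
      left_inv := fun σ => by
        apply Subtype.ext
        change (galTransport K).symm ⟨(galTransport K σ.1 : absoluteGaloisGroup ℚ), _⟩ = σ.1
        rw [Subtype.coe_eta, ContinuousMulEquiv.symm_apply_apply]
      right_inv := fun g => by
        apply Subtype.ext
        change (((galTransport K) ((galTransport K).symm ⟨g.1, g.2.2⟩) : ΓK K) : absoluteGaloisGroup ℚ) = g.1
        rw [ContinuousMulEquiv.apply_symm_apply]
      map_mul' := fun σ τ => Subtype.ext (by
        change (((galTransport K) (σ.1 * τ.1) : ΓK K) : absoluteGaloisGroup ℚ) = _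
        rw [map_mul]; rfl)
      continuous_toFun := by
        apply Continuous.subtype_mk
        exact continuous_subtype_val.comp ((galTransport K).continuous.comp continuous_subtype_val)
      continuous_invFun := by
        apply Continuous.subtype_mk
        exact (galTransport K).symm.continuous.comp (Continuous.subtype_mk
          (continuous_subtype_val) _) }⟩

variable (K' : IntermediateField ℚ (AlgebraicClosure ℚ)) [NumberField K']

/-- **R2 in the `Ω₀`-model (the shape consumed by R4).**  For number fields `K, K′ ⊆ Ω₀`, nontrivial valuation
subrings `A, A′ ⊆ Ω₀`, the places `v` of `↥K` under `A` and `v′` of `↥K′` under `A′`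
(`((x : ↥K) : Ω₀) ∈ 𝔪_A ↔ x ∈ 𝔭_v`), and ANY isomorphism of topological groups
`D_A ⊓ Γ_K ≃ₜ* D_{A′} ⊓ Γ_{K′}` inside `Γ = Gal(Ω₀/ℚ)`: the residue characteristics, the local degrees, the
residue cardinalities, and the residue degrees and ramification indices over `ℤ` AND over `𝓞 ℚ`, coincide.
[cite: NeukirchSchmidtWingberg2008, Ch. XII §2 (12.2.1)] -/
theorem invariants_of_stabilizer_inf_ΓK_equiv
    (A : ValuationSubring (AlgebraicClosure ℚ)) (hA : A ≠ ⊤) (v : HeightOneSpectrum (𝓞 K))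
    (hv : ∀ x : 𝓞 K, (((x : K) : AlgebraicClosure ℚ)) ∈ A.nonunits ↔ x ∈ v.asIdeal)
    (A' : ValuationSubring (AlgebraicClosure ℚ)) (hA' : A' ≠ ⊤) (v' : HeightOneSpectrum (𝓞 K'))
    (hv' : ∀ x : 𝓞 K', (((x : K') : AlgebraicClosure ℚ)) ∈ A'.nonunits ↔ x ∈ v'.asIdeal)
    (e : ↥(MulAction.stabilizer (absoluteGaloisGroup ℚ) A ⊓ ΓK K) ≃ₜ*
      ↥(MulAction.stabilizer (absoluteGaloisGroup ℚ) A' ⊓ ΓK K')) :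
    (∀ p : ℕ, p.Prime → ((p : 𝓞 K) ∈ v.asIdeal ↔ (p : 𝓞 K') ∈ v'.asIdeal)) ∧
      localDeg K v = localDeg K' v' ∧ v.residueCard = v'.residueCard ∧
      v.asIdeal.inertiaDeg ℤ = v'.asIdeal.inertiaDeg ℤ ∧
      v.asIdeal.ramificationIdx ℤ = v'.asIdeal.ramificationIdx ℤ ∧
      v.asIdeal.inertiaDeg (𝓞 ℚ) = v'.asIdeal.inertiaDeg (𝓞 ℚ) ∧
      v.asIdeal.ramificationIdx (𝓞 ℚ) = v'.asIdeal.ramificationIdx (𝓞 ℚ) := by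
  obtain ⟨𝔓, h𝔓v, h𝔓⟩ := exists_primesAbove_of_below K A hA v hv
  obtain ⟨𝔓', h𝔓v', h𝔓'⟩ := exists_primesAbove_of_below K' A' hA' v' hv'
  obtain ⟨e₁⟩ := nonempty_decompositionGroupNF_comap_equiv_stabilizer_inf_ΓK K A
  obtain ⟨e₂⟩ := nonempty_decompositionGroupNF_comap_equiv_stabilizer_inf_ΓK K' A'
  let α := e₁.trans (e.trans e₂.symm)
  haveI : v.asIdeal.IsMaximal := v.isMaximal
  haveI : v'.asIdeal.IsMaximal := v'.isMaximal
  have hf := inertiaDeg_eq_of_decompositionGroupNF_equiv h𝔓v h𝔓 h𝔓v' h𝔓' α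
  have he := ramificationIdx_eq_of_decompositionGroupNF_equiv h𝔓v h𝔓 h𝔓v' h𝔓' α
  refine ⟨fun p hp => natCast_mem_asIdeal_iff_of_decompositionGroupNF_equiv h𝔓v h𝔓 h𝔓v' h𝔓' α hp,
    localDeg_eq_of_decompositionGroupNF_equiv h𝔓v h𝔓 h𝔓v' h𝔓' α,
    residueCard_eq_of_decompositionGroupNF_equiv h𝔓v h𝔓 h𝔓v' h𝔓' α, hf, he, ?_, ?_⟩
  · rw [inertiaDeg_ringOfIntegersRat_eq_int', inertiaDeg_ringOfIntegersRat_eq_int', hf]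
  · rw [ramificationIdx_ringOfIntegersRat_eq_int', ramificationIdx_ringOfIntegersRat_eq_int', he]

end OmegaModel

end NeukirchUchidaProof

end Literature.AnabelianGeometry.AbsoluteAnabelian
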